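import Summits.KontsevichZagierPeriods.KontsevichZagierPeriods.Theorems.TerasomaMultiplicationBetaCancellationStubTameFormAux26

/-!
# `BetaCancellation` (stmt-KontsevichZagierPeriods-13633), line `divisor-slicing-transshipment` — stub `stub_tameForm`, auxiliary file 27: rule (3) has vanishing shadow

**Rule (3) (Newton–Leibniz) has vanishing `K₀`-shadow.** Take a cylindrical decomposition of
`ℝⁿ⁺¹` adapted to the closed band, the sign sets `{f > 0}`, `{f < 0}`, the non-smooth locus of `F`
and the cylinders over `τ` and over `{a < b}` (`IsSemialgebraic.exists_cylindricalDecomposition`,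
Basu–Pollack–Roy Cor. 5.7). Partition both sides over the base cells (rule (1a) shadows); a base
cell is open or null (`IsSACell`), inside or outside `τ` and `{a < b}`; the null / outside /
`a = b` cases are trivial and the open `a < b` case is auxiliary file 26.

References: M. Kontsevich, D. Zagier, *Periods* (2001), §1.2 rule (3); S. Basu, R. Pollack,
M.-F. Roy (2006), Cor. 5.7; crux NOTES c6 (F13).
-/

noncomputable section

-- `Summit.KontsevichZagierPeriods.KontsevichZagierPeriods.…` is the tree's mandated layout (single-conjunct summit).
set_option linter.dupNamespace false

namespace Summit.KontsevichZagierPeriods.KontsevichZagierPeriods.BetaCancellationDivisorSlicing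

open MeasureTheory Set Function Filter
open scoped Topology
open Literature.NumberTheory.Transcendental
open Literature.NumberTheory.Transcendental.KZ
open Literature.ModelTheory.ExponentialFields (IsSemialgebraic isSemialgebraic_univ bandLower bandUpper bandOver graphOver
  bandLower_of_ne_zero bandUpper_of_ne_last mem_bandOver_iff mem_graphOver_iff snoc_mem_bandOver_iff snoc_mem_graphOver_iff
  isSemialgebraic_bandOver' interior_graphOver_eq_empty isSemialgebraicMapOn_snoc IsCylindricalDecomposition
  IsSACell isOpen_bandOver)
open Literature.ModelTheory.ExponentialFields.CylindricalDecomposition (band_eq_band not_mem_band_of_eq exists_mem_band)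

variable {n : ℕ}

/-- Cells of a `ℚ`-cylindrical decomposition are open or null. [cite: Dries1998, Ch. 3 (2.4)] -/
theorem cell_isOpen_or_null {𝒮 : Finset (Set (Fin n → ℝ))} (h𝒮 : IsCylindricalDecomposition ℚ n 𝒮) {S : Set (Fin n → ℝ)}
    (hS : S ∈ 𝒮) : IsOpen S ∨ volume S = 0 := by
  obtain ⟨d, hcell⟩ := IsCylindricalDecomposition.exists_isSACell h𝒮 S hS
  rcases eq_or_lt_of_le hcell.le with hd | hd
  · exact Or.inl (hcell.isOpen hd)
  · exact Or.inr (volume_eq_zero_of_interior_eq_empty hcell.isSemialgebraic (hcell.interior_eq_empty hd))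

/-- **Rule (3), the Newton–Leibniz move, has vanishing shadow.** [cite: KontsevichZagier2001, §1.2 rule (3)] -/
theorem Shadow.of_mem_newtonLeibnizRel {c : FormalRep} (hc : c ∈ newtonLeibnizRel) : Nonempty (Shadow c) := by
  classical
  obtain ⟨n, R, B, a, b, F, hF, ha, hb, hable, hdom, hcont, hderiv, hval, rfl⟩ := hc
  -- the smooth locus of `F` and the adapted decomposition
  obtain ⟨GF, hGFsub, hGFo, -, hGFsm, hZsa, hZnull⟩ := exists_isOpen_contDiffOn R.isSemialgebraic_domain hF
  have hτ := B.isSemialgebraic_domain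
  have hcylτ : IsSemialgebraic ℚ {z : Fin (n + 1) → ℝ | (Fin.init z : Fin n → ℝ) ∈ B.domain} := hτ.preimage_comp Fin.castSucc
  have hlt : IsSemialgebraic ℚ {x | x ∈ B.domain ∧ a x < b x} := isSemialgebraic_sep_lt' ha hb
  have hcyllt : IsSemialgebraic ℚ {z : Fin (n + 1) → ℝ | (Fin.init z : Fin n → ℝ) ∈ {x | x ∈ B.domain ∧ a x < b x}} :=
    hlt.preimage_comp Fin.castSucc
  let 𝓕 : Finset (Set (Fin (n + 1) → ℝ)) := {R.domain, posSet R, negSet R, R.domain \ GF,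
    {z | (Fin.init z : Fin n → ℝ) ∈ B.domain}, {z | (Fin.init z : Fin n → ℝ) ∈ {x | x ∈ B.domain ∧ a x < b x}}}
  have h𝓕 : ∀ s ∈ 𝓕, IsSemialgebraic ℚ s := by
    intro s hs
    simp only [𝓕, Finset.mem_insert, Finset.mem_singleton] at hs
    rcases hs with rfl | rfl | rfl | rfl | rfl | rfl
    exacts [R.isSemialgebraic_domain, isSemialgebraic_posSet R, isSemialgebraic_negSet R, hZsa, hcylτ, hcyllt]
  obtain ⟨𝒯, h𝒯, hadapt⟩ := Literature.ModelTheory.ExponentialFields.IsSemialgebraic.exists_cylindricalDecomposition_holds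
    (k := ℚ) 𝓕 h𝓕
  obtain ⟨𝒮, h𝒮, l, ξ, hξc, hξs, hmono, hmem⟩ := h𝒯.2.2
  have hpart := h𝒯.1
  have hbase := h𝒮.isPartition
  have hsd : ∀ {E : Set (Fin (n + 1) → ℝ)}, E ∈ 𝓕 → ∀ {T}, T ∈ 𝒯 → T ⊆ E ∨ Disjoint T E := fun hE _ hT =>
    IsCylindricalDecomposition.subset_or_disjoint h𝒯 (hadapt _ hE) hT
  have hmem𝓕 : R.domain ∈ 𝓕 ∧ posSet R ∈ 𝓕 ∧ negSet R ∈ 𝓕 ∧ R.domain \ GF ∈ 𝓕 ∧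
      {z : Fin (n + 1) → ℝ | (Fin.init z : Fin n → ℝ) ∈ B.domain} ∈ 𝓕 ∧
      {z : Fin (n + 1) → ℝ | (Fin.init z : Fin n → ℝ) ∈ {x | x ∈ B.domain ∧ a x < b x}} ∈ 𝓕 := by
    simp [𝓕]
  -- base cells: membership of a point determines the cell
  have hbase_eq : ∀ {S S' : Set (Fin n → ℝ)}, S ∈ 𝒮 → S' ∈ 𝒮 → ∀ {x}, x ∈ S → x ∈ S' → S = S' := by
    intro S S' hS hS' x hx hx'
    by_contra hne
    exact (IsCylindricalDecomposition.disjoint_of_ne h𝒮 hS hS' hne).le_bot ⟨hx, hx'⟩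
  have hSsa : ∀ S ∈ 𝒮, IsSemialgebraic ℚ S := h𝒮.isSemialgebraic
  -- the restricted representations
  have hRSsa : ∀ S : 𝒮, IsSemialgebraic ℚ (R.domain ∩ {z : Fin (n + 1) → ℝ | (Fin.init z : Fin n → ℝ) ∈ (S : Set (Fin n → ℝ))}) :=
    fun S => R.isSemialgebraic_domain.inter ((hSsa S S.2).preimage_comp Fin.castSucc)
  let RS : 𝒮 → IntegralRep (n + 1) := fun S => R.restrict _ (hRSsa S) inter_subset_left
  let BS : 𝒮 → IntegralRep n := fun S => B.restrict _ (hτ.inter (hSsa S S.2)) inter_subset_left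
  -- A. partitions over the base cells
  obtain ⟨SA⟩ := Shadow.of_partition' R RS (fun S => inter_subset_left) (fun S z _ => rfl)
    (fun S S' hne => by
      refine measure_mono_null (fun z hz => ?_) measure_empty
      exact hne (Subtype.ext (hbase_eq S.2 S'.2 hz.1.2 hz.2.2)))
    (by
      refine measure_mono_null (fun z hz => ?_) measure_empty
      obtain ⟨S, ⟨hS, hzS⟩, -⟩ := hbase.2 (Fin.init z)
      exact hz.2 (mem_iUnion.mpr ⟨⟨S, hS⟩, hz.1, hzS⟩))
  obtain ⟨SB⟩ := Shadow.of_partition' B BS (fun S => inter_subset_left) (fun S z _ => rfl)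
    (fun S S' hne => by
      refine measure_mono_null (fun z hz => ?_) measure_empty
      exact hne (Subtype.ext (hbase_eq S.2 S'.2 hz.1.2 hz.2.2)))
    (by
      refine measure_mono_null (fun z hz => ?_) measure_empty
      obtain ⟨S, ⟨hS, hzS⟩, -⟩ := hbase.2 z
      exact hz.2 (mem_iUnion.mpr ⟨⟨S, hS⟩, hz.1, hzS⟩))
  -- C. cell by cell
  have hC : ∀ S : 𝒮, Nonempty (Shadow (of (RS S) - of (BS S))) := by
    rintro ⟨S, hS⟩
    -- trivial when both domains are null
    have htriv : volume (R.domain ∩ {z : Fin (n + 1) → ℝ | (Fin.init z : Fin n → ℝ) ∈ S}) = 0 →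
        (volume (B.domain ∩ S) = 0 ∨ EqOn B.integrand 0 (B.domain ∩ S)) →
        Nonempty (Shadow (of (RS ⟨S, hS⟩) - of (BS ⟨S, hS⟩))) := fun h1 h2 => by
      obtain ⟨S1⟩ := Shadow.of_volume_zero (RS ⟨S, hS⟩) h1
      obtain ⟨S2⟩ := h2.elim (fun h => Shadow.of_volume_zero (BS ⟨S, hS⟩) h) (fun h => Shadow.of_eqOn_zero (BS ⟨S, hS⟩) h)
      exact S1.sub S2
    rcases cell_isOpen_or_null h𝒮 hS with hSo | hSnull
    swap
    · -- null base cell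
      refine htriv (measure_mono_null inter_subset_right (volume_setOf_init_mem_eq_zero hSnull)) (Or.inl ?_)
      exact measure_mono_null inter_subset_right hSnull
    -- open base cell: inside or outside `τ`, `a < b` or `a = b`
    obtain ⟨d, hcell⟩ := IsCylindricalDecomposition.exists_isSACell h𝒮 S hS
    obtain ⟨x₀, hx₀⟩ := hcell.nonempty
    have hT0 : bandOver S (ξ S) 0 ∈ 𝒯 := (hmem _).mpr ⟨S, hS, Or.inr ⟨0, rfl⟩⟩
    have hin_or_out : ∀ {E : Set (Fin n → ℝ)}, {z : Fin (n + 1) → ℝ | (Fin.init z : Fin n → ℝ) ∈ E} ∈ 𝓕 →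
        S ⊆ E ∨ Disjoint S E := by
      intro E hE
      rcases hsd hE hT0 with h | h
      · left
        intro x hx
        obtain ⟨t, ht⟩ := exists_mem_band (ξ S) x (hmono S hS x hx) 0
        have := h (show (Fin.snoc x t : Fin (n + 1) → ℝ) ∈ bandOver S (ξ S) 0 by simp [hx, ht.2])
        simpa using this
      · right
        rw [Set.disjoint_left]
        intro x hx hxE
        obtain ⟨t, ht⟩ := exists_mem_band (ξ S) x (hmono S hS x hx) 0
        exact h.le_bot ⟨show (Fin.snoc x t : Fin (n + 1) → ℝ) ∈ bandOver S (ξ S) 0 by simp [hx, ht.2],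
          by simpa using hxE⟩
    rcases hin_or_out hmem𝓕.2.2.2.2.1 with hSτ | hSτ
    swap
    · -- outside `τ`
      refine htriv (measure_mono_null (fun z hz => ?_) measure_empty) (Or.inl ?_)
      · rw [hdom] at hz
        exact hSτ.le_bot ⟨hz.2, hz.1.1⟩
      · rw [Disjoint.inter_eq hSτ.symm, measure_empty]
    rcases hin_or_out hmem𝓕.2.2.2.2.2 with hSlt | hSlt
    swap
    · -- `a = b` on `S`
      have hab : ∀ x ∈ S, a x = b x := fun x hx => by
        have h1 := hable x (hSτ hx)
        by_contra hne
        exact hSlt.le_bot ⟨hx, hSτ hx, lt_of_le_of_ne h1 hne⟩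
      refine htriv ?_ (Or.inr fun x hx => by simp [hval x hx.1, hab x hx.2])
      refine volume_eq_zero_of_interior_eq_empty (hRSsa ⟨S, hS⟩) ?_
      have hsub : R.domain ∩ {z : Fin (n + 1) → ℝ | (Fin.init z : Fin n → ℝ) ∈ S} ⊆ graphOver S a := by
        intro z hz
        rw [hdom] at hz
        refine ⟨hz.2, le_antisymm ?_ hz.1.2.1⟩
        rw [hab _ hz.2]; exact hz.1.2.2
      exact subset_empty_iff.mp ((interior_mono hsub).trans (interior_graphOver_eq_empty S a).le)
    -- the main case: `a < b` on the open cell `S ⊆ τ`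
    have hab : ∀ x ∈ S, a x < b x := fun x hx => (hSlt hx).2
    refine exists_cellShadow R B a b F hF hdom hcont hderiv hval hSo (hSsa S hS) hSτ ⟨x₀, hx₀⟩ hab (ξ S) (hξc S hS)
      (hξs S hS) (hmono S hS) (Finset.univ.filter fun j => graphOver S (ξ S j) ⊆ R.domain)
      (Finset.univ.filter fun j => bandOver S (ξ S) j ⊆ R.domain) (fun j hj => (Finset.mem_filter.mp hj).2)
      (fun j hj => (Finset.mem_filter.mp hj).2) (fun z hz hzS => ?_) (fun j hj => ?_) (fun j hj z hz => ?_)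
      (RS ⟨S, hS⟩) rfl rfl (BS ⟨S, hS⟩) (inter_eq_right.mpr hSτ) rfl
    · -- covering
      obtain ⟨T, ⟨hT, hzT⟩, -⟩ := hpart.2 z
      obtain ⟨S₂, hS₂, hTS⟩ := (hmem T).mp hT
      have hTsub : T ⊆ R.domain := by
        rcases hsd hmem𝓕.1 hT with h | h
        · exact h
        · exact absurd (h.le_bot ⟨hzT, hz⟩) id
      rcases hTS with ⟨j, rfl⟩ | ⟨j, rfl⟩
      · have : S₂ = S := hbase_eq hS₂ hS (mem_graphOver_iff.mp hzT).1 hzS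
        subst this
        exact Or.inl ⟨j, Finset.mem_filter.mpr ⟨Finset.mem_univ _, hTsub⟩, hzT⟩
      · have : S₂ = S := hbase_eq hS₂ hS (mem_bandOver_iff.mp hzT).1 hzS
        subst this
        exact Or.inr ⟨j, Finset.mem_filter.mpr ⟨Finset.mem_univ _, hTsub⟩, hzT⟩
    · -- sign of `f` on the band
      have hT : bandOver S (ξ S) j ∈ 𝒯 := (hmem _).mpr ⟨S, hS, Or.inr ⟨j, rfl⟩⟩
      have hTsub : bandOver S (ξ S) j ⊆ R.domain := (Finset.mem_filter.mp hj).2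
      rcases hsd hmem𝓕.2.1 hT with h | h
      · exact Or.inl fun z hz => (h hz).2
      rcases hsd hmem𝓕.2.2.1 hT with h' | h'
      · exact Or.inr (Or.inl fun z hz => (h' hz).2)
      refine Or.inr (Or.inr fun z hz => ?_)
      rcases lt_trichotomy (R.integrand z) 0 with hlt | heq | hgt
      · exact absurd (h'.le_bot ⟨hz, hTsub hz, hlt⟩) id
      · exact heq
      · exact absurd (h.le_bot ⟨hz, hTsub hz, hgt⟩) id
    · -- smoothness of `F` on the band
      have hT : bandOver S (ξ S) j ∈ 𝒯 := (hmem _).mpr ⟨S, hS, Or.inr ⟨j, rfl⟩⟩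
      have hTsub : bandOver S (ξ S) j ⊆ R.domain := (Finset.mem_filter.mp hj).2
      have hTo : IsOpen (bandOver S (ξ S) j) := isOpen_bandOver hSo (hξc S hS) j
      rcases hsd hmem𝓕.2.2.2.1 hT with h | h
      · exfalso
        have hpos : 0 < volume (bandOver S (ξ S) j) := hTo.measure_pos volume ⟨z, hz⟩
        exact hpos.ne' (measure_mono_null h hZnull)
      · have hzG : z ∈ GF := by
          by_contra hzG
          exact h.le_bot ⟨hz, hTsub hz, hzG⟩
        exact (hGFsm.differentiableOn (by simp)).differentiableAt (hGFo.mem_nhds hzG)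
  -- D. combine
  obtain ⟨SC⟩ := Shadow.sum Finset.univ (fun S : 𝒮 => of (RS S) - of (BS S)) fun S _ => hC S
  obtain ⟨S1⟩ := SA.add SC
  obtain ⟨S2⟩ := S1.sub SB
  refine S2.congr ?_
  simp only [Finset.sum_sub_distrib]
  abel

/-! ### Headline -/

/-- Registered helper goal of the stub `stub_tameForm`: rule (3), the Newton–Leibniz move, has
vanishing `K₀`-shadow. [cite: KontsevichZagier2001, §1.2 rule (3)] -/
theorem tameForm_aux_shadowNewtonLeibniz : ∀ c ∈ newtonLeibnizRel, Nonempty (Shadow c) :=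
  fun _ hc => Shadow.of_mem_newtonLeibnizRel hc

end Summit.KontsevichZagierPeriods.KontsevichZagierPeriods.BetaCancellationDivisorSlicing

end
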